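import Literature.NumberTheory.Automorphic.HyperspecialUnitarySatakeTransform   -- ★ `satakeWeight`, `satakeTwistExp`, `residueCardSqrt(_sq)`; brings `Valued K ℤᵐ⁰`
import HarnessLib

/-!
# R90 · S6 — card F5 (B2c) «HYPERBOLIC JACOBIANS»: the scalar bookkeeping of the hyperbolic half of the Hecke-basis fundamental lemma —
# Satake weights on the lines `ℓ_m`, the valuations `|d₀⁻¹u − 1|_w`, `|d₀⁻¹d₂ − 1|_w` on the Hecke stratum `ord_w d₀ = ∓m ≠ 0`, and the cancellation
# `J_H · w_H⁻¹ · (−1)^m = Δ‴ · J_G · w_G⁻¹` (`Theorems/R90S6HyperbolicJacobians.lean`)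

Cell `hodgecm-mathlib`, crux H413 (`stmt-HodgeConjecture-24833`), route `HCCMUnconditional`; R90-TF section S6 (base `R90-C14`), seat R90-C14-p09 (g0); card F5
(B2c) (dealer R90-C14-plan (g2) RULING F5-R1 2026-09-05T01:10:47Z «you type (B2c) `Theorems/R90S6HyperbolicJacobians.lean` NOW … each as its own small public
lemma, API exception ≤ 10»), DAG row E1.3.6.2.  Lane `--supports stmt-HodgeConjecture-24833 --as helper`; THEOREMS ONLY (no definition ∕ instance ∕ notation ∕
named fact ∕ `sorry`); imports = ★ `HyperspecialUnitarySatakeTransform` + HarnessLib.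

THE MATHEMATICS [Rogawski1990, §4.9 (4.9.2) and Prop. 4.9.1 (b) p. 55; CartierCorvallis1979 §IV (4.2)].  On the Levi stratum the clause of (4.3.1) is ONE
term on each side (★ `LocalDeltaTransferLeviStratum`): `Φ_H(⟦γ_H⟧, φ^H) = Δ‴(γ_H, γ₀) · Φ_G(⟦γ₀⟧, φ)`.  By the ★ canonical descents
(`classOrbitalIntegral_eq_smul_integral_prod_of_torus_regular`, `…_prod_…_of_nonsplit`) and Cartier's formula (★ (B1) `R90S6ConstantTermSatakeCoeff`):
`Φ_G = J_G(t) · w₃(ℓ_m)⁻¹ · S^G_m`, `Φ_H = J_H(t) · w₂(ℓ_m)⁻¹ · S^H_m` with `S^G_m = 𝒮₃(φ)_{ℓ_m}`, `S^H_m = 𝒮₂(φ^H)_{ℓ_m}`, the Satake weights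
`w₃(ℓ_m) = Q^{−m}`, `w₂(ℓ_m) = q^{−m}` (`Q = q² = #𝓀_w`, `q = q_v`) — §1 — and the Jacobians `J_G = (‖a − 1‖ · √‖b − 1‖)⁻¹`, `J_H = (√‖b − 1‖)⁻¹`
(★ `twistModule_cmLocal_eq`, `a = d₀⁻¹u`, `b = d₀⁻¹d₂`), whose values on the Hecke stratum follow from the valuations of §2: for `ord_w d₀ = m > 0`
(`log v_w d₀ = −m < 0`): `|a − 1|_w = |b − 1|_w^{1∕2} = Q^m`; for `m < 0`: both `1`.  With the graph identity `S^H_m = (−1)^m S^G_m` ((B2b), p04) and ★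
`transferFactor_diag_value_of_valued_ne_one` (`Δ‴ = (−q)^{|m|}`) the clause is the scalar identity of §3:
`J_H · w₂⁻¹ · (−1)^m = Δ‴ · J_G · w₃⁻¹`, i.e. `Q^{−m} q^m (−1)^m = (−q)^m Q^{−2m} Q^m` (`m > 0`) and `q^{m} (−1)^m = (−q)^{−m} Q^{m}` (`m < 0`).

WHAT IS PROVED (9 public lemmas): §1 `satakeWeight_lineThree` (`w(ℓ³_m) = q^{−2m}`), `satakeWeight_lineThree_residueCardSqrt` (`= (Q^m)⁻¹` for `q = √Q`),
`satakeWeight_lineTwo` (`w(ℓ²_m) = q^{−m}`, p03's `U(1,1)` line `(m(1 − 2i))_i`); §2 (any valued field `F`, value group `ℤᵐ⁰`; `v u = 1`, `v d₀ = exp ℓ`,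
`v d₂ = exp (−ℓ)` — the torus relations of ★ `HeisRing.torus_relations` read at the fixed place): `valued_inv_mul_sub_one_of_neg ∕ _of_pos`
(`v(d₀⁻¹u − 1) = exp(−ℓ)` ∕ `= 1`), `valued_inv_mul_sub_one_of_neg' ∕ _of_pos'` (`v(d₀⁻¹d₂ − 1) = exp(−2ℓ)` ∕ `= 1`) — the inputs of ★
`normAbs_eq_inv_zpow_of_valued_eq`; §3 `hyperbolicJacobian_identity_of_pos ∕ _of_neg` (the two cancellations, any `q ≠ 0` in `ℂ`).
HONEST LABEL: scalar bookkeeping for the E1.3.6.2 assembly (B2d); proves no printed global statement, discharges no citation; count-neutral.  HC_CM is proved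
only modulo the 7 printed citations (2 remaining named inputs: hLiu418 = stmt-HodgeConjecture-24832, h413 = stmt-HodgeConjecture-24833) until rung 0 closes;
REL ≠ ★ ≠ BUILT.

## Tree search
★ `satakeWeight`, `satakeTwistExp`, `residueCardSqrt_sq` [SatakeTransformGL, HyperspecialUnitarySatakeTransform]; ★ `transferFactor_diag_value(_of_valued_ne_one)`
[Theorems/R90S6TransferFactorDiag(Hecke)]; ★ `twistModule_cmLocal_eq(_prod_normAbs)` [UnitaryGroupRegularTwistModulus :201]; ★ `normAbs_eq_inv_zpow_of_valued_eq`
[AddCharConductorExponent :346]; ★ `unitModulusChar_eq_inv_absNorm_of_valued_eq` [HeisenbergStrataMeasureRamified :87]; Mathlib `Valuation.map_sub_eq_of_lt_left∕right`,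
`WithZero.exp_neg ∕ exp_add ∕ exp_lt_exp`, `Fin.sum_univ_three ∕ two`.  Dedup: `rg "satakeWeight_line|valued_inv_mul_sub_one|hyperbolicJacobian"` over `lean/` — no hit.

## References
* [Rogawski1990] J. D. Rogawski, *Automorphic Representations of Unitary Groups in Three Variables*, Ann. of Math. Stud. 123 (1990), §4.9 (4.9.2), Prop. 4.9.1 (b) p. 55.
* [CartierCorvallis1979] P. Cartier, *Representations of 𝔭-adic groups: a survey*, PSPM 33.1 (1979), §IV (4.2).
-/

set_option autoImplicit false
-- the mandated namespace repeats the single-problem summit's segment (`HodgeConjecture.HodgeConjecture`)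
set_option linter.dupNamespace false

noncomputable section

open scoped Valued WithZero

namespace Summit.HodgeConjecture.HodgeConjecture.R90.S6

open Literature.NumberTheory.Automorphic Literature.NumberTheory.Automorphic.HermitianLattice

/-! ## §1 Satake weights on the lines `ℓ³_m = (m, 0, −m)` and `ℓ²_m = (m, −m)` -/

/-- `⟨ν, ℓ³_m⟩ = 2m` for the `U(3)` line `ℓ³_m = (m(1 − t))_t = (m, 0, −m)` (`ν = (2, 1, 0)`). [cite: CartierCorvallis1979, §IV (4.2)] -/
private theorem satakeTwistExp_lineThree (m : ℤ) : satakeTwistExp (fun t : Fin 3 => m * (1 - (t : ℕ))) = 2 * m := by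
  simp only [satakeTwistExp, Fin.sum_univ_three, Fin.isValue, Fin.val_zero, Fin.val_one, Fin.val_two, Nat.cast_zero, Nat.cast_one, Nat.cast_ofNat]
  ring

/-- `⟨ν, ℓ²_m⟩ = m` for the `U(1,1)` line `ℓ²_m = (m(1 − 2i))_i = (m, −m)` (`ν = (1, 0)`). [cite: CartierCorvallis1979, §IV (4.2)] -/
private theorem satakeTwistExp_lineTwo (m : ℤ) : satakeTwistExp (fun i : Fin 2 => m * (1 - 2 * (i : ℕ))) = m := by
  simp only [satakeTwistExp, Fin.sum_univ_two, Fin.isValue, Fin.val_zero, Fin.val_one, Nat.cast_zero, Nat.cast_one, Nat.cast_ofNat]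
  ring

/-- **`w₃(ℓ_m) = q^{−2m}`**: the Satake weight `q^{−⟨ν,a⟩}` (★ `satakeWeight`, `q` = the chosen square root of the residue cardinality) on the `U(3)` line
`ℓ_m = (m, 0, −m)`. [cite: CartierCorvallis1979, §IV (4.2)] -/
theorem satakeWeight_lineThree (q : ℂ) (m : ℤ) : satakeWeight q (fun t : Fin 3 => m * (1 - (t : ℕ))) = q ^ (-(2 * m)) := by
  rw [satakeWeight, satakeTwistExp_lineThree]

/-- **`w₃(ℓ_m) = (Q^m)⁻¹`** with `Q = #𝓀[K] = (residueCardSqrt K)²` — the `δ_B^{1∕2}`-weight of the `U(3)` line at `q = residueCardSqrt K`. [cite: CartierCorvallis1979, §IV (4.2)] -/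
theorem satakeWeight_lineThree_residueCardSqrt (K : Type*) [Field K] [Valued K ℤᵐ⁰] (m : ℤ) :
    satakeWeight (residueCardSqrt K) (fun t : Fin 3 => m * (1 - (t : ℕ))) = ((Nat.card 𝓀[K] : ℂ) ^ m)⁻¹ := by
  rw [satakeWeight_lineThree, zpow_neg, zpow_mul, ← residueCardSqrt_sq, zpow_ofNat]

/-- **`w₂(ℓ_m) = q^{−m}`** on the `U(1,1)` line `ℓ_m = (m, −m)` (p03's spelling `(m(1 − 2i))_i`). [cite: CartierCorvallis1979, §IV (4.2)] -/
theorem satakeWeight_lineTwo (q : ℂ) (m : ℤ) : satakeWeight q (fun i : Fin 2 => m * (1 - 2 * (i : ℕ))) = q ^ (-m) := by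
  rw [satakeWeight, satakeTwistExp_lineTwo]

/-! ## §2 Valuations on the diagonal torus `diag(d₀, u, d₂)`, `v(u) = 1`, `v(d₂) = v(d₀)⁻¹`, read at one place -/

section Valued

variable {F : Type*} [Field F] [Valued F ℤᵐ⁰]

/-- `v(d₀⁻¹u) = exp(−ℓ)` for `v d₀ = exp ℓ`, `v u = 1`. [cite: Rogawski1990, §4.9 p. 55] -/
private theorem valued_inv_mul_eq {d₀ u : F} {ℓ : ℤ} (hd₀ : Valued.v d₀ = WithZero.exp ℓ) (hu : Valued.v u = 1) :
    Valued.v (d₀⁻¹ * u) = WithZero.exp (-ℓ) := by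
  rw [map_mul, map_inv₀, hd₀, hu, mul_one, WithZero.exp_neg]

/-- **Hecke stratum `ord_w d₀ > 0` (`log v d₀ = ℓ < 0`): `v(d₀⁻¹u − 1) = v(d₀)⁻¹ = exp(−ℓ)`** — the `α`-root factor `|a − 1|_w = Q^{|ℓ|}` is LARGE off `T(𝒪)`.
[cite: Rogawski1990, §4.9 p. 55] -/
theorem valued_inv_mul_sub_one_of_neg {d₀ u : F} {ℓ : ℤ} (hd₀ : Valued.v d₀ = WithZero.exp ℓ) (hu : Valued.v u = 1) (hℓ : ℓ < 0) :
    Valued.v (d₀⁻¹ * u - 1) = WithZero.exp (-ℓ) := by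
  have h1 := valued_inv_mul_eq hd₀ hu
  have hlt : Valued.v (1 : F) < Valued.v (d₀⁻¹ * u) := by
    rw [map_one, h1, ← WithZero.exp_zero, WithZero.exp_lt_exp]
    omega
  rw [Valuation.map_sub_eq_of_lt_left _ hlt, h1]

/-- **Hecke stratum `ord_w d₀ < 0` (`log v d₀ = ℓ > 0`): `v(d₀⁻¹u − 1) = 1`.** [cite: Rogawski1990, §4.9 p. 55] -/
theorem valued_inv_mul_sub_one_of_pos {d₀ u : F} {ℓ : ℤ} (hd₀ : Valued.v d₀ = WithZero.exp ℓ) (hu : Valued.v u = 1) (hℓ : 0 < ℓ) :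
    Valued.v (d₀⁻¹ * u - 1) = 1 := by
  have h1 := valued_inv_mul_eq hd₀ hu
  have hlt : Valued.v (d₀⁻¹ * u) < Valued.v (1 : F) := by
    rw [map_one, h1, ← WithZero.exp_zero, WithZero.exp_lt_exp]
    omega
  rw [Valuation.map_sub_eq_of_lt_right _ hlt, map_one]

/-- **`v(d₀⁻¹d₂ − 1) = exp(−2ℓ)` for `log v d₀ = ℓ < 0`, `v d₂ = exp(−ℓ)`** (the `σ(d₂)d₀ = 1` torus relation at the fixed place: `|b − 1|_w^{1∕2} = Q^{|ℓ|}`).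
[cite: Rogawski1990, §4.9 p. 55] -/
theorem valued_inv_mul_sub_one_of_neg' {d₀ d₂ : F} {ℓ : ℤ} (hd₀ : Valued.v d₀ = WithZero.exp ℓ) (hd₂ : Valued.v d₂ = WithZero.exp (-ℓ)) (hℓ : ℓ < 0) :
    Valued.v (d₀⁻¹ * d₂ - 1) = WithZero.exp (-(2 * ℓ)) := by
  have h1 : Valued.v (d₀⁻¹ * d₂) = WithZero.exp (-(2 * ℓ)) := by
    rw [map_mul, map_inv₀, hd₀, hd₂, ← WithZero.exp_neg, ← WithZero.exp_add, show -ℓ + -ℓ = -(2 * ℓ) by ring]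
  have hlt : Valued.v (1 : F) < Valued.v (d₀⁻¹ * d₂) := by
    rw [map_one, h1, ← WithZero.exp_zero, WithZero.exp_lt_exp]
    omega
  rw [Valuation.map_sub_eq_of_lt_left _ hlt, h1]

/-- **`v(d₀⁻¹d₂ − 1) = 1` for `log v d₀ = ℓ > 0`, `v d₂ = exp(−ℓ)`.** [cite: Rogawski1990, §4.9 p. 55] -/
theorem valued_inv_mul_sub_one_of_pos' {d₀ d₂ : F} {ℓ : ℤ} (hd₀ : Valued.v d₀ = WithZero.exp ℓ) (hd₂ : Valued.v d₂ = WithZero.exp (-ℓ)) (hℓ : 0 < ℓ) :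
    Valued.v (d₀⁻¹ * d₂ - 1) = 1 := by
  have h1 : Valued.v (d₀⁻¹ * d₂) = WithZero.exp (-(2 * ℓ)) := by
    rw [map_mul, map_inv₀, hd₀, hd₂, ← WithZero.exp_neg, ← WithZero.exp_add, show -ℓ + -ℓ = -(2 * ℓ) by ring]
  have hlt : Valued.v (d₀⁻¹ * d₂) < Valued.v (1 : F) := by
    rw [map_one, h1, ← WithZero.exp_zero, WithZero.exp_lt_exp]
    omega
  rw [Valuation.map_sub_eq_of_lt_right _ hlt, map_one]

end Valued

/-! ## §3 The two cancellations `J_H · w₂⁻¹ · (−1)^m = Δ‴ · J_G · w₃⁻¹` -/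

/-- **The hyperbolic Jacobian identity, `m = n > 0`**: `J_H = (Q^n)⁻¹`, `w₂⁻¹ = q^n`, `J_G = (Q^n · Q^n)⁻¹`, `w₃⁻¹ = Q^n`, `Δ‴ = (−q)^n`, `Q = q²`:
`J_H · w₂⁻¹ · (−1)^n = Δ‴ · (J_G · w₃⁻¹)`. [cite: Rogawski1990, §4.9 Prop. 4.9.1 (b), (4.9.2) p. 55] -/
theorem hyperbolicJacobian_identity_of_pos (q : ℂ) (hq : q ≠ 0) (n : ℕ) :
    ((q ^ 2) ^ n)⁻¹ * q ^ n * (-1) ^ n = (-q) ^ n * ((((q ^ 2) ^ n * (q ^ 2) ^ n)⁻¹) * (q ^ 2) ^ n) := by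
  have hQ : (q ^ 2) ^ n ≠ 0 := pow_ne_zero _ (pow_ne_zero _ hq)
  field_simp
  ring

/-- **The hyperbolic Jacobian identity, `m = −n < 0`**: `J_H = J_G = 1`, `w₂⁻¹ = (q^n)⁻¹`, `w₃⁻¹ = (Q^n)⁻¹`, `Δ‴ = (−q)^n`, `(−1)^m = (−1)^n`:
`w₂⁻¹ · (−1)^n = Δ‴ · w₃⁻¹`. [cite: Rogawski1990, §4.9 Prop. 4.9.1 (b), (4.9.2) p. 55] -/
theorem hyperbolicJacobian_identity_of_neg (q : ℂ) (hq : q ≠ 0) (n : ℕ) :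
    (q ^ n)⁻¹ * (-1) ^ n = (-q) ^ n * ((q ^ 2) ^ n)⁻¹ := by
  have hq' : q ^ n ≠ 0 := pow_ne_zero _ hq
  have hQ : (q ^ 2) ^ n ≠ 0 := pow_ne_zero _ (pow_ne_zero _ hq)
  field_simp
  ring

end Summit.HodgeConjecture.HodgeConjecture.R90.S6

end
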